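import Summits.Ventures.HSemireg.WedgeHankelRecurrenceGaussGegenbauerDiscriminant

/-!
# Venture HSemireg — **THE PRODUCT OF THE CHRISTOFFEL NUMBERS**: for a positive recurrence (`b_j > 0`) with Gauss nodes `x_0 < ⋯ < x_t` (`q_{t+1} = ∏ (X − x_k)`) and Christoffel numbers
# `λ_k = (b_1 ⋯ b_t) ∕ (q_{t+1}′(x_k) q_t(x_k))` (the form used in N384 ∕ N313) one has **`∏_k q_{t+1}′(x_k) = (−1)^{t(t+1)∕2} disc(q_{t+1})`** (any field, any nodes) and, with SCHUR's
# `∏_k q_t(x_k) = (−1)^{t(t+1)∕2} ∏ b_j^j` (N403), the identity **`(∏_k λ_k) · disc(q_{t+1}) = ∏_{j=1}^{t} b_j^{t+1−j}`**; also `disc(q_{t+1}) > 0`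

HONEST FRAMING. Part of the Lean index of the computation cell `pub-hsemireg` (seat p10 gen 47, Sunday typer «UNIFORM-IN-n»).  Polynomial algebra over a field ∕ `ℝ` (Mathlib `Polynomial.resultant ∕
discr`) only; no variety, no cohomology theory, no sheaf, no Ext group and no semiregularity map is constructed here; nothing here says that HC / HC_CM / HC_AV holds; no Literature fact (unproved
`Prop`) is declared or used.  Custodian versions as in `WedgeHankelSiegelIdeal` (1/3).
SOURCES (cited).  G. Szegő, *Orthogonal Polynomials*, (3.4.7) (`λ_ν = k_{n+1}∕(k_n p_{n+1}′(x_ν) p_n(x_ν))`, monic: `λ_ν = (b_1⋯b_n)∕(q_{n+1}′(x_ν) q_n(x_ν))`) and §6.71 (Schur's `∏ q_n(x_ν)`);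
I. Schur, J. reine angew. Math. 165 (1931) 52–58, §1.  The product identity for `∏ λ_ν` is an immediate COROLLARY of these two printed facts and of `∏_ν f′(x_ν) = (−1)^{n(n−1)∕2} disc f`
(Mathlib `resultant_deriv` read through `resultant_prod_left`); no separate printed source is claimed for it.
PROOF TYPED HERE.  `Res_{(t+1,t)}(∏(X − x_k), f′) = ∏ f′(x_k)` (Mathlib `resultant_prod_left`, `resultant_X_sub_C_left`) and `= (−1)^{(t+1)t∕2} disc f` (`resultant_deriv`, monic); then N403
`prod_eval_pred_at_zeros`, `∏ (B∕(f′_k g_k)) = B^{t+1}∕(∏ f′_k ∏ g_k)`, the signs square to `1`, and `∏_{j<t} b_{j+1}^{t−j} · ∏_{j<t} b_{j+1}^{j+1} = (∏_{j<t} b_{j+1})^{t+1}`.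
DEDUP DISCLOSURE (`rg -n -i 'christoffel.*prod|prod.*weight|prod_eval_derivative' Summits/Ventures/HSemireg/WedgeHankelRecurrenceGauss*`, 2026-09-04): N284 `eval_derivative_prod_X_sub_C_at_node`
(one node), N313 ∕ N384 (single weights); no product formula; 0 hits for the 4 names below.

WHAT IS IN THE TREE.  N403 `prod_eval_pred_at_zeros`; N653-block `discr_prod_X_sub_C`; N247 `recurrence_zeros_interlace` (ordered zeros with the factorisation); Mathlib `resultant_deriv`,
`resultant_prod_left`, `resultant_X_sub_C_left`, `Finset.prod_Ico_eq_prod_range`, `Finset.prod_div_distrib`, `Finset.prod_pow`.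
THIS FILE (namespace `Summit.Ventures.HSemireg.Wedge.HankelOuter` continued; CHAINED on N409 (import only); 0 definitions):
* §1175 **`prod_eval_derivative_nodes`** (`∏_k f′(x_k) = (−1)^{t(t+1)∕2} disc f`, `f = ∏_{k ≤ t} (X − x_k)`, any field, any nodes), `discr_nodes_ne_zero` (distinct nodes ⇒ `disc f ≠ 0`),
  **`christoffel_numbers_prod_mul_discr`** (`(∏_k λ_k) disc(q_{t+1}) = ∏_{j<t} b_{j+1}^{t−j}`), `recurrence_discr_pos` (`b > 0 ⇒ disc q_{t+1} > 0`).
CAVEATS.  `λ_k` is written out as the quotient `(∏_{l ∈ [1,t]} b_l) ∕ (q_{t+1}′(x_k) q_t(x_k))` exactly as in N384; that these quotients ARE the Gauss–Favard weights is N313 ∕ N266 and is not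
re-proved here.  Nothing Ext-side.  New names only.
-/

open Module Polynomial
open scoped Matrix Polynomial

namespace Summit.Ventures.HSemireg.Wedge.HankelOuter

/-! ## §1175. The product of the Christoffel numbers -/

/-- **`∏_k f′(x_k) = (−1)^{t(t+1)∕2} · disc f` for `f = ∏_{k ≤ t} (X − x_k)`** over any field (no distinctness needed). [Szegő §6.71 (the classical `D = (−1)^{n(n−1)∕2} ∏ f′(x_ν)` for monic `f`);
this file, §1175] -/
theorem prod_eval_derivative_nodes {K : Type*} [Field K] {t : ℕ} (x : Fin (t + 1) → K) :
    ∏ k, (derivative (∏ i, (Polynomial.X - C (x i)))).eval (x k) = (-1) ^ (t * (t + 1) / 2) * (∏ i, (Polynomial.X - C (x i))).discr := by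
  have hfm : (∏ i, (Polynomial.X - C (x i))).Monic := monic_prod_of_monic _ _ fun i _ => monic_X_sub_C (x i)
  have hfd : (∏ i, (Polynomial.X - C (x i))).natDegree = t + 1 := by rw [natDegree_finsetProd_X_sub_C_eq_card, Finset.card_univ, Fintype.card_fin]
  have key := resultant_deriv (f := ∏ i, (Polynomial.X - C (x i))) (natDegree_pos_iff_degree_pos.mp (by omega))
  rw [hfd, Nat.add_sub_cancel, hfm.leadingCoeff, mul_one, show (t + 1) * t / 2 = t * (t + 1) / 2 by rw [mul_comm]] at key
  have hlc : ∏ i ∈ (Finset.univ : Finset (Fin (t + 1))), (Polynomial.X - C (x i)).leadingCoeff ≠ 0 := by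
    rw [Finset.prod_eq_one fun i _ => leadingCoeff_X_sub_C (x i)]; exact one_ne_zero
  have hd' : (derivative (∏ i, (Polynomial.X - C (x i)))).natDegree ≤ t := (natDegree_derivative_le _).trans (by omega)
  have h2 := resultant_prod_left Finset.univ (fun k => Polynomial.X - C (x k)) (derivative (∏ i, (Polynomial.X - C (x i)))) t hlc hd'
  rw [natDegree_finsetProd_X_sub_C_eq_card, Finset.card_univ, Fintype.card_fin, key] at h2
  rw [h2]
  exact Finset.prod_congr rfl fun k _ => by rw [natDegree_X_sub_C, resultant_X_sub_C_left _ _ _ hd']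

/-- Distinct nodes ⇒ `disc(∏ (X − x_k)) ≠ 0`. [this file, §1175] -/
theorem discr_nodes_ne_zero {K : Type*} [Field K] {t : ℕ} {x : Fin (t + 1) → K} (hx : Function.Injective x) : (∏ i, (Polynomial.X - C (x i))).discr ≠ 0 := by
  rw [discr_prod_X_sub_C]
  exact pow_ne_zero _ (Finset.prod_ne_zero_iff.2 fun i _ => Finset.prod_ne_zero_iff.2 fun j hj => sub_ne_zero.2 fun h => (Finset.mem_Ioi.1 hj).ne' (hx h))

/-- **THE PRODUCT OF THE CHRISTOFFEL NUMBERS: `(∏_k λ_k) · disc(q_{t+1}) = ∏_{j<t} b_{j+1}^{t−j}`**, `λ_k = (b_1⋯b_t)∕(q_{t+1}′(x_k) q_t(x_k))`, for a positive recurrence and its ordered Gauss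
nodes. [corollary of Szegő (3.4.7) + Schur 1931 §1 + `∏ f′(x_ν) = ±disc`; this file, §1175] -/
theorem christoffel_numbers_prod_mul_discr {q : ℕ → ℝ[X]} {a b : ℕ → ℝ} (hq0 : q 0 = 1) (hq1 : q 1 = Polynomial.X - C (a 0))
    (hrec : ∀ n, q (n + 2) = (Polynomial.X - C (a (n + 1))) * q (n + 1) - C (b (n + 1)) * q n) (hb : ∀ j, 0 < b j) {t : ℕ} {x : Fin (t + 1) → ℝ}
    (hx : StrictMono x) (hxq : q (t + 1) = ∏ k, (Polynomial.X - C (x k))) :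
    (∏ k, (∏ l ∈ Finset.Ico 1 (t + 1), b l) / ((derivative (q (t + 1))).eval (x k) * (q t).eval (x k))) * (q (t + 1)).discr = ∏ j ∈ Finset.range t, b (j + 1) ^ (t - j) := by
  have hD := prod_eval_derivative_nodes x
  have hdisc := discr_nodes_ne_zero hx.injective
  rw [← hxq] at hD hdisc
  have hP := prod_eval_pred_at_zeros hq0 hq1 hrec hxq
  have hPne : ∏ j ∈ Finset.range t, b (j + 1) ^ (j + 1) ≠ 0 := Finset.prod_ne_zero_iff.2 fun j _ => pow_ne_zero _ (hb _).ne'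
  have hS : (-1 : ℝ) ^ (t * (t + 1) / 2) ≠ 0 := pow_ne_zero _ (by norm_num)
  have hsq : ((-1 : ℝ) ^ (t * (t + 1) / 2)) * ((-1 : ℝ) ^ (t * (t + 1) / 2)) = 1 := by rw [← pow_add, ← two_mul, pow_mul, neg_one_sq, one_pow]
  have hB : ∏ l ∈ Finset.Ico 1 (t + 1), b l = ∏ j ∈ Finset.range t, b (j + 1) := by
    rw [Finset.prod_Ico_eq_prod_range, Nat.add_sub_cancel]; exact Finset.prod_congr rfl fun j _ => by rw [add_comm]
  have hsplit : (∏ j ∈ Finset.range t, b (j + 1)) ^ (t + 1) = (∏ j ∈ Finset.range t, b (j + 1) ^ (t - j)) * ∏ j ∈ Finset.range t, b (j + 1) ^ (j + 1) := by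
    rw [← Finset.prod_pow, ← Finset.prod_mul_distrib]
    exact Finset.prod_congr rfl fun j hj => by rw [← pow_add]; congr 1; have := Finset.mem_range.1 hj; omega
  rw [Finset.prod_div_distrib, Finset.prod_const, Finset.card_univ, Fintype.card_fin, Finset.prod_mul_distrib, hD, hP, hB, hsplit, div_mul_eq_mul_div,
    div_eq_iff (mul_ne_zero (mul_ne_zero hS hdisc) (mul_ne_zero hS hPne))]
  linear_combination (-((∏ j ∈ Finset.range t, b (j + 1) ^ (t - j)) * (∏ j ∈ Finset.range t, b (j + 1) ^ (j + 1)) * (q (t + 1)).discr)) * hsq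

/-- **A positive recurrence has `disc(q_{t+1}) > 0`** (`t + 1` distinct real zeros; N247 supplies them). [Szegő Thm 3.3.1 + (6.71.1); this file, §1175] -/
theorem recurrence_discr_pos {q : ℕ → ℝ[X]} {a b : ℕ → ℝ} (hq0 : q 0 = 1) (hq1 : q 1 = Polynomial.X - C (a 0))
    (hrec : ∀ n, q (n + 2) = (Polynomial.X - C (a (n + 1))) * q (n + 1) - C (b (n + 1)) * q n) (hb : ∀ j, 0 < b j) (t : ℕ) : 0 < (q (t + 1)).discr := by
  obtain ⟨z, -, hz, -, hzq, -, -⟩ := recurrence_zeros_interlace hq0 hq1 hrec hb t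
  rw [hzq, discr_prod_X_sub_C]
  exact lt_of_le_of_ne (sq_nonneg _) (by rw [← discr_prod_X_sub_C]; exact (discr_nodes_ne_zero hz.injective).symm)

end Summit.Ventures.HSemireg.Wedge.HankelOuter
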